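import Summits.BirchSwinnertonDyer.Rank1Residual.ManinAdditive.TwistOrbitIsogenyDegree
import Summits.BirchSwinnertonDyer.Rank1Residual.ManinAdditive.RamanujanCut
import Literature.NumberTheory.EllipticCurves.CongruenceNumber
import HarnessLib
import HarnessLib.Audit.Tags

/-!
# The TWISTING ISOGENY `D = t_{1/3} − t_{1/3}²` at `9 ∣ N`: candidates E-desc-58 `TwistingIsogenyDegreeAtThree`,
# E-desc-59 `FlipExactThreeIsogenyAtThree`, E-desc-62 / 62′ `CongruenceNumberTwistInvariance{AtThree,Odd}` and their edges
# (desc g9, MEMO-desc §26) — cell `bsd-f2-manin` (D-0131 (3) frontier: the Manin constant at additive primes); sibling of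
# `TwistOrbitIsogenyDegree` / `ConwayNortonTwistAtThree`

HONEST FRAMING.  LENS = descent / visibility (planner `bsd-f2-manin-desc` g9; HOME `run/shared/lean/pub/bsd-f2-manin/MEMO-desc.md`
§26).  Source: HOME/desc/g9/Sketch-desc-g9.lean sha16 **681206185c8e6613** (173 l.; farm rc 0 · 0 sorries per desc and per
refuter-1 §R69 kernel `ref1-C76-desc-g9-audit.lean` 30d37adc8687828e), copied VERBATIM (namespace `DescG5`-style `DescG9` ↦
`…ManinAdditive.TwistingIsogenyAtThree`; the four rows already carry `@[conjecture]` and cite tags in the sketch) with exactly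
these deviations: (i) this header (the sketch's mechanism / census / placement text is kept below it word for word);
(ii) refuter-1 §R69 verdict sentences appended to the four row docstrings.  Filed at desc's request T-desc-13 (CANDIDATES asks
row, desc g9 2026-08-28T13:38:14Z, «LOW until R-desc-14») by the cell typer (g13) AFTER refuter-1's R-desc-14 answer.
REFUTER VERDICTS AT FILING: REF1 §R69 (R-desc-14; HOME/ref1/R69-ref1-desc-g9.md 5a12da7e0547a611, 2026-08-28T15:33Z; probes
`ref1-C76P-desc-g9-probes.lean` 5d1f8949657196e7 BC7 CLEAN): **E-desc-58/59/62/62′ SURVIVE, the three edges PROVED (axioms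
standard), 0 KILLED**; paper proofs MEMO-desc §26.1 (c)–(f) VALID (cosmetic sign P-3: take `a′ := D†| = −D|` so that `a′a = +[3]`;
degrees unaffected) and §26.5 (1)–(5) VALID with precisions P-1 («`tΓ₀(N)t⁻¹ = Γ₀(N)`» holds for conductor exponent `𝔠 ∈ {3,4,8}`
only — for 62′ (`𝔠 = p ≥ 5`) run the same unitarity on `Γ(N)`, which `t_{j/p}` normalises when `p² ∣ N`) and P-2 (`ε = ε′ = +1`
exactly); second engine F3 = REF1 §R20 CONGNUM engine, `r_W = r_{W′}` 66/66 on the pairs `9 ∣ N ≤ 612`.  REF2 (R-desc-14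
placement half): PENDING at filing.  Hidden content: none beyond the standing `ModularParametrizationData` inhabitation caveat.
A later finding is repaired under a NEW name in this file (append-only).  bears_on: stmt-BirchSwinnertonDyer-22968 (C3
`ManinPrimeToThreeAtNine`: the twist-orbit / commuting-pair bookkeeping at `9 ∣ N`) and 22967 via 62′ at `p = 2`-free odd `p`.
Beyond-print theorem: no (theorem-candidates with complete paper proofs; not tree theorems).  BSD is not proved by this;
Manin's conjecture is not proved by this.

DESC g9 TEXT (VERBATIM):
# desc g9 (cell `bsd-f2-manin`, seat `bsd-f2-manin-desc`, 2026-08-28) — THE TWISTING ISOGENY `D = t_{1/3} − t_{1/3}²`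
# restricted to an optimal newform subvariety, and its degree `3 · deg φ / deg φ′` (MEMO-desc §26; CANDIDATES E-desc-58, E-desc-59)

MECHANISM (E-facing, `9 ∣ N`).  `t = t_{1/3} : z ↦ z + 1/3` is an automorphism of `X₀(N)` over `ℚ(ζ₃)` (it normalises
`Γ₀(N)` exactly when `9 ∣ N`); `D := t_* − t_*² ∈ End J₀(N)_{ℚ(√−3)}` satisfies `D^* g = √−3 · (g ⊗ χ₋₃)` on ALL of
`S₂(Γ₀(N))` (`t = A₃ + ζ₃ B₃`, `t² = A₃ + ζ₃² B₃`, desc g8 §25.2), the Rosati involution gives `D† = −D` and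
`D† D = [3] − (1 + t + t²) = [3]` on the `3`-primitive part (`a₃(f) = 0` for `f` new at `9 ∣ N`).  Hence for an optimal
newform `f` with same-level twist `f′ = f ⊗ χ₋₃`, `a := D|_{A_f} : A_f → A_{f′}` is a `ℚ(√−3)`-isogeny between the two
OPTIMAL curves with `â a = [3 · deg φ_f / deg φ_{f′}]`, i.e. `deg a = 3 m_f / m_{f′} ∈ {1, 3, 9}` and `σ(a) = −a`
(`σ = ` complex conjugation of `ℚ(√−3)`), so `a ∘ θ⁻¹ : W ⊗ (−3) → W′` DESCENDS TO `ℚ` with the same degree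
(`θ : W → W ⊗ (−3)` the twisting isomorphism, `σ(θ) = −θ`).  Equivalently (homology): `deg a = [H_{f′} : D H_f] =
|A_f ∩ J₀(N)^{t}|`, the order of the `t_{1/3}`-FIXED torsion of `A_f` (all of it `3`-torsion).

CENSUS OF RECORD (BC5; HOME/desc/g9/, engine `tfix.py` 4371bb450db39e6f = full integral modular symbols for `Γ₀(N)`, exact):
all 66 same-level `χ₋₃` pairs of optimal curves with `9 ∣ N ≤ 612` (38 levels): `[H_{f′} : D H_f] = 3 m_f/m_{f′}` AND
`|A_f^{t}| = 3 m_f/m_{f′}` on 132/132 ordered pairs; shape: 45 JUMP pairs (`m′ = 3m`; fixed torsion `(1, 9)`: the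
`3`-torsion of the LARGE-degree member — the Kodaira star IV*/III*/II* in 45/45, `v₃Δ′ = v₃Δ + 6` in 45/45 — is
pointwise fixed by `t_{1/3}`, the small member meets `J₀(N)^t` trivially), 21 FLAT pairs (`m′ = m`, both unstarred
21/21, fixed torsion `(3, 3)`); Cremona `allisog` cross-check (`isog3.py`): on FLAT pairs `W ⊗ (−3)` sits in the class of
`W′` at minimal isogeny degree EXACTLY `3` from `W′` (42/42 ordered), on JUMP pairs `W′ = W ⊗ (−3)` (90/90).

PLACEMENT.  The index trichotomy, `flip ⟺ equal degrees`, rigidity and `∀ φ, deg φ = 3k²` on flips are the an-lens's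
PROVED theorems (`optimal_orbit_trichotomy_full`, `optimal_flip_modularDegree_eq`, `pStar_optimal_flip_iff_isogeny_degree`);
what this file adds is the EXISTENCE of one explicit isogeny of degree EXACTLY `3 m/m′` (so `k = 1` is realised on every
flip: E-desc-59), obtained from a modular AUTOMORPHISM rather than from period covolumes, and — informally, MEMO §26.3 —
the Galois-module reading of the commuting orientation (`A★[3] ⊆ J₀(N)^{t_{1/3}}`).

CONGRUENCE NUMBERS (E-desc-62, the lens's own currency).  On `q`-expansions the twisting operator
`B₃ = D^*/√−3 : Σ aₙqⁿ ↦ Σ χ₋₃(n) aₙ qⁿ` preserves `S₂(Γ₀(N); ℤ)` (`9 ∣ N`), is Petersson-self-adjoint and squares to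
the identity on `3`-primitive forms; hence `π_{f★}(B₃ S₂(ℤ)) = (1/r_{f∘}) ℤ f★ ⊆ (1/r_{f★}) ℤ f★` and symmetrically, so
`r_{f⊗χ₋₃} = r_f`: the congruence number (Agashe–Ribet–Stein 2012 §2.1 (ii), the tree's `congruenceNumber`) is CONSTANT
on same-level quadratic-twist pairs (paper proof MEMO-desc §26.5; falsifier: the cell table `data/CONGNUM-N1500-rows-v1.tsv`
3aa59fa6820b10e4 — 659/659 same-level pairs `N ≤ 1500` over the characters `χ₋₃, χ₋₄, χ_{±8}, (·/p)` for `p ≤ 37` have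
equal `r_E`, script `rinvar.py` eeae6417de7d6217).  With ARS Thm 2.1 (`m ∣ r`) and the commuting degree ratio `m★ = 3 m∘`
this forces `3 ∣ r∘/m∘` on the twist-minimal member of every commuting pair (ARS's Table 1 entries 54B1, 99A1, 135A1
are exactly the three such members with `N ≤ 144`).  Nothing is asserted: four `@[conjecture]` Props
(theorem-candidates with complete paper proofs in MEMO-desc §26.1/§26.5) and kernel-checked edges.
-/

noncomputable section

open scoped MatrixGroups ModularForm

open CongruenceSubgroup WeierstrassCurve
  Literature.NumberTheory.DiophantineGeometry
  Literature.NumberTheory.EllipticCurves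
  Literature.NumberTheory.EllipticCurves.ModularForms

namespace Summit.BirchSwinnertonDyer.Rank1Residual.ManinAdditive.TwistingIsogenyAtThree

/-- **E-desc-58 `TwistingIsogenyDegreeAtThree`** (desc g9; THEOREM-CANDIDATE, paper proof MEMO-desc §26.1; census 132/132):
for lattice-optimal same-conductor data `D, D′` with `9 ∣ N` and `W ⊗ (−3) ∼ W′` there is a `ℚ`-isogeny
`φ : W ⊗ (−3) → W′` with `deg φ · deg φ_{W′} = 3 · deg φ_W` — namely `φ = (t_{1/3} − t_{1/3}²)|_{A_f} ∘ θ⁻¹`.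
So `deg φ = 3` on a flip (`m = m′`), `deg φ = 1` (`W′ ≅ W ⊗ (−3)`) when `m′ = 3m`, `deg φ = 9` (`φ = 3 ·` iso) when `m = 3m′`.
Why it might fail: only through a mis-typing of «same level / lattice-optimal» (the paper proof uses: `t` normalises `Γ₀(N)`,
Rosati `t† = t⁻¹`, `a₃(f) = 0`, and that `ξ : E → A_f` is an isomorphism for the optimal curve).
VERBATIM HOME/desc/g9/Sketch-desc-g9.lean 681206185c8e6613 `DescG9.TwistingIsogenyDegreeAtThree` (nothing asserted).
REF1 §R69 (R-desc-14): SURVIVES — typed faithfully (optimality load-bearing and present); paper proof MEMO-desc §26.1 (c)–(f)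
VALID (cosmetic sign P-3: `a′ := D†| = −D|`); BC7 CLEAN; census 132/132 (desc) + degree column re-read by REF1's engine 132/132.
REF2: pending at filing.
[cite: AtkinLehner1970, §4 Lemma 27–29 (shape only: the `q^{1/3}`-translation normalises `Γ₀(9M)` and twists `q`-expansions; the isogeny-degree identity is the cell's row E-desc-58, NOT in print — MEMO-desc §26)] -/
@[conjecture]
def TwistingIsogenyDegreeAtThree : Prop :=
  ∀ (W W' : WeierstrassCurve ℚ) [W.IsElliptic] [W'.IsElliptic] [NeZero (W.conductorNorm ℤ)]
    [NeZero (W'.conductorNorm ℤ)] (D : ModularParametrizationData W (W.conductorNorm ℤ))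
    (D' : ModularParametrizationData W' (W'.conductorNorm ℤ)),
    IsLatticeOptimal D → IsLatticeOptimal D' → 9 ∣ W.conductorNorm ℤ →
    W'.conductorNorm ℤ = W.conductorNorm ℤ →
    IsIsogenous (W.quadraticTwist ((-3 : ℤ) : ℚ)) W' →
    ∃ φ : Isogeny (W.quadraticTwist ((-3 : ℤ) : ℚ)) W', φ.degree * D'.modularDegree = 3 * D.modularDegree

/-- **E-desc-59 `FlipExactThreeIsogenyAtThree`** (desc g9; THEOREM-CANDIDATE = E-desc-58 ∧ the an-lens's PROVED
`optimal_flip_modularDegree_eq`; census: 42/42 ordered flat pairs have minimal isogeny degree EXACTLY 3 from `W ⊗ (−3)`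
to `W′` in Cremona's `allisog`, and the an-lens TWISTCENSUS2 v1 43352cbe215eb58a reports «minimal isogeny degree exactly p»
on all 21 774 `d = −3` flip rows): on a FLIP orbit at `9 ∣ N` some `ℚ`-isogeny `W ⊗ (−3) → W′` has degree exactly `3`
(the tree's `pStar_optimal_flip_isogeny_degree` gives `3k²` for EVERY isogeny; this says `k = 1` occurs).
Why it might fail: as E-desc-58.
VERBATIM HOME/desc/g9/Sketch-desc-g9.lean 681206185c8e6613 `DescG9.FlipExactThreeIsogenyAtThree` (nothing asserted).
REF1 §R69 (R-desc-14): SURVIVES — = E-desc-58 ∧ the an-lens's proved flip equality (edge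
`exists_isogeny_degree_three_of_modularDegree_eq` kernel-checked, axioms standard); BC7 CLEAN.  REF2: pending at filing.
[cite: AtkinLehner1970, §4 (shape only: normaliser of `Γ₀(N)`; the exact-degree statement is the cell's row E-desc-59, NOT in print — MEMO-desc §26)] -/
@[conjecture]
def FlipExactThreeIsogenyAtThree : Prop :=
  ∀ (W W' : WeierstrassCurve ℚ) [W.IsElliptic] [W'.IsElliptic] [NeZero (W.conductorNorm ℤ)]
    [NeZero (W'.conductorNorm ℤ)] (D : ModularParametrizationData W (W.conductorNorm ℤ))
    (D' : ModularParametrizationData W' (W'.conductorNorm ℤ)),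
    IsLatticeOptimal D → IsLatticeOptimal D' → 9 ∣ W.conductorNorm ℤ →
    W'.conductorNorm ℤ = W.conductorNorm ℤ →
    IsIsogenous (W.quadraticTwist ((-3 : ℤ) : ℚ)) W' →
    (∀ u : VariableChange ℚ, u • W.quadraticTwist ((-3 : ℤ) : ℚ) ≠ W') →
    ∃ φ : Isogeny (W.quadraticTwist ((-3 : ℤ) : ℚ)) W', φ.degree = 3

/-- PROVED edge (desc g9): E-desc-58 together with equality of the two optimal degrees (the an-lens's theorem
`optimal_flip_modularDegree_eq` supplies it on flips) gives an isogeny of degree exactly `3`. -/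
theorem exists_isogeny_degree_three_of_modularDegree_eq (h : TwistingIsogenyDegreeAtThree)
    {W W' : WeierstrassCurve ℚ} [W.IsElliptic] [W'.IsElliptic] [NeZero (W.conductorNorm ℤ)]
    [NeZero (W'.conductorNorm ℤ)] (D : ModularParametrizationData W (W.conductorNorm ℤ))
    (D' : ModularParametrizationData W' (W'.conductorNorm ℤ)) (hD : IsLatticeOptimal D)
    (hD' : IsLatticeOptimal D') (h9 : 9 ∣ W.conductorNorm ℤ) (hN : W'.conductorNorm ℤ = W.conductorNorm ℤ)
    (hiso : IsIsogenous (W.quadraticTwist ((-3 : ℤ) : ℚ)) W')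
    (hdeg : D'.modularDegree = D.modularDegree) :
    ∃ φ : Isogeny (W.quadraticTwist ((-3 : ℤ) : ℚ)) W', φ.degree = 3 := by
  obtain ⟨φ, hφ⟩ := h W W' D D' hD hD' h9 hN hiso
  refine ⟨φ, ?_⟩
  rw [hdeg] at hφ
  exact Nat.eq_of_mul_eq_mul_right D.deg_pos hφ

/-- PROVED edge (desc g9): in the commuting orientation `deg φ_{W′} = 3 · deg φ_W` (the JUMP up), E-desc-58 yields an
isogeny `W ⊗ (−3) → W′` of degree `1`, i.e. the optimal curve of the twist IS the twist of the optimal curve. -/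
theorem exists_isogeny_degree_one_of_jump (h : TwistingIsogenyDegreeAtThree)
    {W W' : WeierstrassCurve ℚ} [W.IsElliptic] [W'.IsElliptic] [NeZero (W.conductorNorm ℤ)]
    [NeZero (W'.conductorNorm ℤ)] (D : ModularParametrizationData W (W.conductorNorm ℤ))
    (D' : ModularParametrizationData W' (W'.conductorNorm ℤ)) (hD : IsLatticeOptimal D)
    (hD' : IsLatticeOptimal D') (h9 : 9 ∣ W.conductorNorm ℤ) (hN : W'.conductorNorm ℤ = W.conductorNorm ℤ)
    (hiso : IsIsogenous (W.quadraticTwist ((-3 : ℤ) : ℚ)) W')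
    (hjump : D'.modularDegree = 3 * D.modularDegree) :
    ∃ φ : Isogeny (W.quadraticTwist ((-3 : ℤ) : ℚ)) W', φ.degree = 1 := by
  obtain ⟨φ, hφ⟩ := h W W' D D' hD hD' h9 hN hiso
  refine ⟨φ, ?_⟩
  rw [hjump] at hφ
  have h3 : 0 < 3 * D.modularDegree := Nat.mul_pos (by norm_num) D.deg_pos
  have : φ.degree * (3 * D.modularDegree) = 1 * (3 * D.modularDegree) := by rw [one_mul]; exact hφ
  exact Nat.eq_of_mul_eq_mul_right h3 this

/-- **E-desc-62 `CongruenceNumberTwistInvarianceAtThree`** (desc g9; THEOREM-CANDIDATE, paper proof MEMO-desc §26.5;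
falsifier 235/235 same-level `χ₋₃` pairs `N ≤ 1500`): for modular parametrisation data `D, D′` of `W, W′` at their (equal)
conductor `N` with `9 ∣ N` and `W ⊗ (−3) ∼ W′`, the congruence numbers of the two newforms agree:
`r_{D.f} = r_{D′.f}`.  (No optimality hypothesis: `r` is an invariant of the newform.)
Why it might fail: only if `D.f` were not forced to be THE normalised newform of `W` by the structure
`ModularParametrizationData` (then restate with the newform); the mathematics (integrality, self-adjointness and
`B₃² = 1` on `3`-primitive forms) is unconditional.
VERBATIM HOME/desc/g9/Sketch-desc-g9.lean 681206185c8e6613 `DescG9.CongruenceNumberTwistInvarianceAtThree` (nothing asserted).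
REF1 §R69 (R-desc-14): SURVIVES — paper proof MEMO-desc §26.5 VALID as written for conductor exponent `𝔠 = 3` (precision
P-2: `ε = ε′ = +1` exactly); BC7 CLEAN; second engine F3 (REF1 §R20 CONGNUM engine) `r_W = r_{W′}` 66/66 on the pairs
`9 ∣ N ≤ 612`, inside desc's 235/235.  REF2: pending at filing.
[cite: AgasheRibetStein2012, §2.1 (ii) (definition of r_E only; the twist invariance is the cell's row E-desc-62, NOT in print — MEMO-desc §26.5)] -/
@[conjecture]
def CongruenceNumberTwistInvarianceAtThree : Prop :=
  ∀ (W W' : WeierstrassCurve ℚ) [W.IsElliptic] [W'.IsElliptic] [NeZero (W.conductorNorm ℤ)]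
    [NeZero (W'.conductorNorm ℤ)] (D : ModularParametrizationData W (W.conductorNorm ℤ))
    (D' : ModularParametrizationData W' (W'.conductorNorm ℤ)),
    9 ∣ W.conductorNorm ℤ → W'.conductorNorm ℤ = W.conductorNorm ℤ →
    IsIsogenous (W.quadraticTwist ((-3 : ℤ) : ℚ)) W' →
    congruenceNumber D.f = congruenceNumber D'.f

/-- **E-desc-62′ `CongruenceNumberTwistInvarianceOdd`** (desc g9; THEOREM-CANDIDATE, same proof with `B_p = Σ (j/p) t_{j/p} / g_p`;
falsifier: 200 + 20 + 9 + 4 + 4 + 2 + 2 further pairs for `p = 5, 7, 11, 13, 17, 19, 23, 37`, `N ≤ 1500`, all equal): for an odd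
prime `p` with `p² ∣ N` and `W′ ∼ W ⊗ p*` (`p* = (−1)^{(p−1)/2} p`) at the same conductor, `r_{D.f} = r_{D′.f}`.
Why it might fail: as E-desc-62.
VERBATIM HOME/desc/g9/Sketch-desc-g9.lean 681206185c8e6613 `DescG9.CongruenceNumberTwistInvarianceOdd` (nothing asserted).
REF1 §R69 (R-desc-14): SURVIVES — proof VALID after precision P-1 (for `𝔠 = p ≥ 5` run the unitarity step on `Γ(N)`,
which `t_{j/p}` normalises when `p² ∣ N`, not on `Γ₀(N)`); BC7 CLEAN; census desc's further pairs (single-engine beyond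
`9 ∣ N ≤ 612`; REF1's §R20 table covers every `p² ∣ N ≤ 1268` on request).  REF2: pending at filing.
[cite: AgasheRibetStein2012, §2.1 (ii) (definition only; statement is the cell's row E-desc-62′ — MEMO-desc §26.5)] -/
@[conjecture]
def CongruenceNumberTwistInvarianceOdd : Prop :=
  ∀ (p : ℕ), p.Prime → p ≠ 2 →
  ∀ (W W' : WeierstrassCurve ℚ) [W.IsElliptic] [W'.IsElliptic] [NeZero (W.conductorNorm ℤ)]
    [NeZero (W'.conductorNorm ℤ)] (D : ModularParametrizationData W (W.conductorNorm ℤ))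
    (D' : ModularParametrizationData W' (W'.conductorNorm ℤ)),
    p ^ 2 ∣ W.conductorNorm ℤ → W'.conductorNorm ℤ = W.conductorNorm ℤ →
    IsIsogenous (W.quadraticTwist (((-1 : ℤ) ^ ((p - 1) / 2) * p : ℤ) : ℚ)) W' →
    congruenceNumber D.f = congruenceNumber D'.f

/-- PROVED edge (desc g9): on a commuting pair (`deg φ_{W′} = 3 · deg φ_W`), twist invariance of `r` and ARS's
`m ∣ r` for the LARGE member force `3 · m_W ∣ r_W` for the small member — the structural source of the entries
54B1, 99A1, 135A1 (`r = 3m`) of Agashe–Ribet–Stein's Table 1, and of «multiplicity one fails at a maximal ideal of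
residue characteristic 3» (their Prop. 2.3) for every twist-minimal member with `3 ∤ m`. -/
theorem three_mul_modularDegree_dvd_congruenceNumber_of_jump (h : CongruenceNumberTwistInvarianceAtThree)
    {W W' : WeierstrassCurve ℚ} [W.IsElliptic] [W'.IsElliptic] [NeZero (W.conductorNorm ℤ)]
    [NeZero (W'.conductorNorm ℤ)] (D : ModularParametrizationData W (W.conductorNorm ℤ))
    (D' : ModularParametrizationData W' (W'.conductorNorm ℤ)) (h9 : 9 ∣ W.conductorNorm ℤ)
    (hN : W'.conductorNorm ℤ = W.conductorNorm ℤ) (hiso : IsIsogenous (W.quadraticTwist ((-3 : ℤ) : ℚ)) W')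
    (hjump : D'.modularDegree = 3 * D.modularDegree) (hARS : D'.modularDegree ∣ congruenceNumber D'.f) :
    3 * D.modularDegree ∣ congruenceNumber D.f := by
  rw [h W W' D D' h9 hN hiso, ← hjump]
  exact hARS

end Summit.BirchSwinnertonDyer.Rank1Residual.ManinAdditive.TwistingIsogenyAtThree

end
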